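import Summits.QuantumFields.BalabanUV.T4Continuum.Support.NE7PairChartData
import Summits.QuantumFields.BalabanUV.T4Continuum.Support.NE7PairColourGlue
import Summits.QuantumFields.BalabanUV.T4Continuum.Support.NE7PairSymmetrise
import Summits.QuantumFields.BalabanUV.T4Continuum.Support.NE7PairProfilesSharp
import HarnessLib

/-!
# NE7PairResidualSupRep — THE PAIR RESIDUAL SUP-REPRESENTATIVE (F323b, d = 4, L = 2): two unitary `(N·M)`-periodic configurations `U′`, `U_s` (`M = 2^{k+1}`) with
# plaquettes `η`-close to `1` and THE SAME `(k+1)`-fold block average are GAUGE-CLOSE IN SUP NORM in a RESIDUAL gauge: there is a unitary `(N·M)`-periodic site gauge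
# `u`, trivial at every block corner `M•z`, with `‖U_s(b)⁻¹(U′^{u})(b) − 1‖ ≤ 10³⁴·M·η` on EVERY bond, as soon as `10²¹·card n·M²η ≤ 1`

Cell `pub-balaban`, sub-cell t4, lineage `b2b-balaban-t4-ne7-p1` (CRUX PROVER NE7 #1 = OWNER of row NE7), gen 94; memo
`t4/b2b-balaban-t4-ne7-p1-g94/PAIR-REP-ROAD.md` §9.  THE END of this generation's road (files F315–F323a): the sup member of [Balaban1985RegularSpaces] Lemma 1 ∕
Thm 2 (1.36)₁ AT A PAIR, in the everywhere-small-field case with EQUAL top averages (`α₁ = 0`), on our lattice with our averaging (B7 (42) iterated) — the first conjunct of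
row NE3's per-pair binder `hleaves` of F314b `NE7HintOfUhlenbeckChartSU2.hint_SU2` (`ResidualSliceRepT`'s `gauge`, `cornerTrivial`, `rep`, `sup` members with
`α₀·M ≤ 10³⁴·M²η =: α̂` k-FREE; the slice condition `tangent` and the weight∕currencies are NOT supplied here).  In ε-units (`η = ε∕M²`): `‖U_s⁻¹U′^{u} − 1‖ ≤ 10³⁴ε∕M`.
ROAD (ours, single top scale, no propagators): chart data (F323a) → gluing over the 16 parities with the doubled period `2NM` (F321) → four period halvings (F322).
WHAT ([folklore]; 0 def, 0 sorry): `symmetrise_all` (the four halvings, by induction on the number of treated directions), `pair_residual_sup_rep` (THE END).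
HONEST FRAMING (page 1): a theorem about ARBITRARY pairs of small-field lattice gauge fields with equal top averages; nothing of Bałaban's asserted; hleaves NOT
discharged (its slice∕currency half remains, [Balaban1985RegularSpaces] Sects. D–E TYPE); NE7 NOT PROVED; spine 0∕9; finite T⁴ rung (B)+1 — NOT infinite volume, NOT mass
gap, NOT `BetaPertH`, NOT Clay.  Axioms ⊆ {propext, Classical.choice, Quot.sound}.
-/

set_option autoImplicit false

open scoped BigOperators Matrix Matrix.Norms.L2Operator
open Finset NormedSpace

namespace Summit.QuantumFields.BalabanUV.T4Continuum.NE7PairResidualSupRep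

open Literature.MathematicalPhysics.QuantumFieldTheory.Balaban1983to89
open B7Prop1Explicit B7Prop2Explicit
open T4AveragingDeficitWall (IsUnitaryCfg SmallField)
open T4AveragingDeficitWallBoundary (IsPeriodicCfg)
open AveragingDeficitMultiLevelPrep (cavgIter)
open NE3EnergyShapes (IsUnitarySite IsPeriodicSite)
open NE7PairChartData (exists_pair_chart_data)
open NE7PairColourGlue (colour_glue)
open NE7PairSymmetrise (symmetrise_step)
open NE7PairProfilesSharp (exists_coreProfile_sharp exists_parityBlock_sharp)

noncomputable section

variable {n : Type} [Fintype n] [DecidableEq n] [Nonempty n]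

/-! ## §1 The four period halvings -/

/-- **THE FOUR HALVINGS**: from a unitary pinned gauge, `2NM`-periodic in every direction, `τ`-close to the charts and with pair defect `≤ η`, after treating the first
`m ≤ 4` directions the gauge is `N·M`-periodic in those directions, `2NM`-periodic in all, `9^m τ`-close and with defect `≤ 13^m(η + 16mτ∕M)` (`2·9³·τ ≤ 1∕4`). [folklore] -/
theorem symmetrise_all {U' Us : Site 4 → Fin 4 → (Matrix n n ℂ)ˣ} (hU' : IsUnitaryCfg U') (hUs : IsUnitaryCfg Us) {M N : ℕ} (hM : 1 ≤ M) (hN : 1 ≤ N)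
    (hU'P : IsPeriodicCfg U' ((N * M : ℕ) : ℤ)) (hUsP : IsPeriodicCfg Us ((N * M : ℕ) : ℤ))
    {g : Site 4 → Site 4 → (Matrix n n ℂ)ˣ}
    (hgeq : ∀ (ζ x : Site 4) (j : Fin 4), g (ζ + (N : ℤ) • e j) (x + ((N * M : ℕ) : ℤ) • e j) = g ζ x)
    {u : Site 4 → (Matrix n n ℂ)ˣ} {τ η : ℝ} (hτ0 : 0 ≤ τ) (hη0 : 0 ≤ η) (hτ : 5832 * τ ≤ 1)
    (huU : ∀ x, u x ∈ unitaryUnits (Matrix n n ℂ)) (hupin : ∀ ζ : Site 4, u ((M : ℤ) • ζ) = 1)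
    (huper : ∀ (x : Site 4) (j : Fin 4), u (x + ((2 * N * M : ℕ) : ℤ) • e j) = u x)
    (husite : ∀ x (ζ : Site 4), (∀ j, |x j - (M : ℤ) * ζ j| ≤ (M : ℤ)) →
      ‖((u x : (Matrix n n ℂ)ˣ) : Matrix n n ℂ) - ((g ζ x : (Matrix n n ℂ)ˣ) : Matrix n n ℂ)‖ ≤ τ)
    (hubond : ∀ (x : Site 4) (μ : Fin 4), ‖(((Us x μ)⁻¹ * gaugeAct u U' x μ : (Matrix n n ℂ)ˣ) : Matrix n n ℂ) - 1‖ ≤ η) :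
    ∀ m : ℕ, m ≤ 4 → ∃ w : Site 4 → (Matrix n n ℂ)ˣ,
      (∀ x, w x ∈ unitaryUnits (Matrix n n ℂ)) ∧ (∀ ζ : Site 4, w ((M : ℤ) • ζ) = 1) ∧
      (∀ (x : Site 4) (j : Fin 4), w (x + ((2 * N * M : ℕ) : ℤ) • e j) = w x) ∧
      (∀ (x : Site 4) (j : Fin 4), (j : ℕ) < m → w (x + ((N * M : ℕ) : ℤ) • e j) = w x) ∧
      (∀ x (ζ : Site 4), (∀ j, |x j - (M : ℤ) * ζ j| ≤ (M : ℤ)) →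
        ‖((w x : (Matrix n n ℂ)ˣ) : Matrix n n ℂ) - ((g ζ x : (Matrix n n ℂ)ˣ) : Matrix n n ℂ)‖ ≤ 9 ^ m * τ) ∧
      (∀ (x : Site 4) (μ : Fin 4), ‖(((Us x μ)⁻¹ * gaugeAct w U' x μ : (Matrix n n ℂ)ˣ) : Matrix n n ℂ) - 1‖
        ≤ 13 ^ m * (η + 16 * m * τ / (M : ℝ))) := by
  letI : CStarAlgebra (Matrix n n ℂ) := {}
  have hM0 : (0 : ℝ) < M := by exact_mod_cast (by omega : 0 < M)
  intro m
  induction m with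
  | zero =>
      intro _
      refine ⟨u, huU, hupin, huper, fun x j hj => absurd hj (Nat.not_lt_zero _), fun x ζ hζ => by simpa using husite x ζ hζ, fun x μ => by simpa using hubond x μ⟩
  | succ m ih =>
      intro hm
      obtain ⟨w, hwU, hwpin, hwper, hwhalf, hwsite, hwbond⟩ := ih (Nat.le_of_succ_le hm)
      have hm4 : m < 4 := Nat.lt_of_succ_le hm
      set i : Fin 4 := ⟨m, hm4⟩ with hi
      -- smallness at this stage: `2·9^m τ ≤ 1/4` for `m ≤ 3`
      have h9m : (9 : ℝ) ^ m ≤ 729 := by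
        calc (9 : ℝ) ^ m ≤ 9 ^ 3 := pow_le_pow_right₀ (by norm_num) (by omega)
          _ = 729 := by norm_num
      have hτm : 2 * (9 ^ m * τ) ≤ 1 / 4 := by nlinarith
      have hηm : 0 ≤ 13 ^ m * (η + 16 * m * τ / (M : ℝ)) := by positivity
      obtain ⟨w', hw'U, hw'pin, hw'half, hw'inh, hw'site, hw'bond⟩ :=
        symmetrise_step (d := 4) hUs hU' hM hN i (fun x μ => hUsP x i μ) (fun x μ => hU'P x i μ) hgeq hηm hτm hwU hwpin (fun x => hwper x i)
          hwsite hwbond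
      refine ⟨w', hw'U, hw'pin, fun x j => ?_, fun x j hj => ?_, fun x ζ hζ => ?_, fun x μ => ?_⟩
      · -- `2NM`-periodicity in every direction is inherited (`2NM ∣ (2NM e_j) i`)
        refine hw'inh (((2 * N * M : ℕ) : ℤ) • e j) ?_ (fun y => hwper y j) x
        simp only [Pi.smul_apply, e_apply, smul_eq_mul]
        split_ifs
        · exact ⟨1, by push_cast; ring⟩
        · exact ⟨0, by simp⟩
      · -- `NM`-periodicity in the treated directions
        rcases Nat.lt_succ_iff_lt_or_eq.mp hj with hj | hj
        · refine hw'inh (((N * M : ℕ) : ℤ) • e j) ?_ (fun y => hwhalf y j hj) x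
          simp only [Pi.smul_apply, e_apply, smul_eq_mul]
          have hji : j ≠ i := by intro h; rw [h, hi] at hj; exact lt_irrefl _ hj
          rw [if_neg (Ne.symm hji), mul_zero]; exact ⟨0, by simp⟩
        · have hji : j = i := Fin.ext (by rw [hi]; exact hj)
          rw [hji]; exact hw'half x
      · calc _ ≤ 9 * (9 ^ m * τ) := hw'site x ζ hζ
          _ = 9 ^ (m + 1) * τ := by rw [pow_succ]; ring
      · have h := hw'bond x μ
        have hstep : 13 * (13 ^ m * (η + 16 * m * τ / (M : ℝ))) + 16 * (9 ^ m * τ) / (M : ℝ)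
            ≤ 13 ^ (m + 1) * (η + 16 * ((m + 1 : ℕ) : ℝ) * τ / (M : ℝ)) := by
          have h913 : (9 : ℝ) ^ m ≤ 13 ^ (m + 1) := by
            calc (9 : ℝ) ^ m ≤ 13 ^ m := pow_le_pow_left₀ (by norm_num) (by norm_num) m
              _ ≤ 13 ^ (m + 1) := pow_le_pow_right₀ (by norm_num) (Nat.le_succ m)
          have hτM : 0 ≤ τ / (M : ℝ) := div_nonneg hτ0 hM0.le
          have e1 : 13 * (13 ^ m * (η + 16 * m * τ / (M : ℝ))) + 16 * (9 ^ m * τ) / (M : ℝ)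
              = 13 ^ (m + 1) * (η + 16 * m * τ / (M : ℝ)) + 16 * 9 ^ m * (τ / (M : ℝ)) := by rw [pow_succ]; ring
          have e2 : 13 ^ (m + 1) * (η + 16 * ((m + 1 : ℕ) : ℝ) * τ / (M : ℝ))
              = 13 ^ (m + 1) * (η + 16 * m * τ / (M : ℝ)) + 16 * 13 ^ (m + 1) * (τ / (M : ℝ)) := by push_cast; ring
          rw [e1, e2]
          nlinarith
        push_cast at h hstep ⊢
        linarith

/-! ## §2 THE END -/

/-- **THE PAIR RESIDUAL SUP-REPRESENTATIVE** (see the file header): for unitary `(N·2^{k+1})`-periodic `U′`, `U_s` with `SmallField · η`, the SAME `(k+1)`-fold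
average and `10²¹·card n·(2^{k+1})²η ≤ 1`: a unitary `(N·2^{k+1})`-periodic site gauge `u`, trivial at the block corners `2^{k+1}•z`, with
`‖U_s(b)⁻¹(U′^{u})(b) − 1‖ ≤ 10³⁴·2^{k+1}·η` on every bond. [folklore] -/
theorem pair_residual_sup_rep {U' Us : Site 4 → Fin 4 → (Matrix n n ℂ)ˣ} (hU' : IsUnitaryCfg U') (hUs : IsUnitaryCfg Us) {k N : ℕ} (hN : 1 ≤ N)
    (hU'P : IsPeriodicCfg U' ((N * 2 ^ (k + 1) : ℕ) : ℤ)) (hUsP : IsPeriodicCfg Us ((N * 2 ^ (k + 1) : ℕ) : ℤ)) {η : ℝ} (hη : 0 < η)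
    (hS' : SmallField U' η) (hSs : SmallField Us η) (htop : cavgIter 2 (k + 1) U' = cavgIter 2 (k + 1) Us)
    (hθ : 1000000000000000000000 * (Fintype.card n : ℝ) * (((2 : ℝ) ^ (k + 1)) ^ 2 * η) ≤ 1) :
    ∃ u : Site 4 → (Matrix n n ℂ)ˣ, IsUnitarySite u ∧ IsPeriodicSite u ((N * 2 ^ (k + 1) : ℕ) : ℤ) ∧
      (∀ z : Site 4, u (((2 ^ (k + 1) : ℕ) : ℤ) • z) = 1) ∧
      ∀ (x : Site 4) (μ : Fin 4), ‖(((Us x μ)⁻¹ * gaugeAct u U' x μ : (Matrix n n ℂ)ˣ) : Matrix n n ℂ) - 1‖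
        ≤ 10000000000000000000000000000000000 * (2 : ℝ) ^ (k + 1) * η := by
  letI : CStarAlgebra (Matrix n n ℂ) := {}
  set M : ℕ := 2 ^ (k + 1) with hMdef
  have hM2 : 2 ≤ M := by
    rw [hMdef]
    calc 2 = 2 ^ 1 := by norm_num
      _ ≤ 2 ^ (k + 1) := Nat.pow_le_pow_right (by norm_num) (by omega)
  have hM1 : 1 ≤ M := le_trans (by norm_num) hM2
  have hMr : (M : ℝ) = (2 : ℝ) ^ (k + 1) := by rw [hMdef]; push_cast; ring
  have hM0 : (0 : ℝ) < M := by exact_mod_cast (by omega : 0 < M)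
  have hM2r : (2 : ℝ) ≤ M := by exact_mod_cast hM2
  set θ : ℝ := (M : ℝ) ^ 2 * η with hθdef
  have hθ0 : 0 ≤ θ := by positivity
  have hcard : (1 : ℝ) ≤ Fintype.card n := by exact_mod_cast Fintype.card_pos
  have hθ' : 1000000000000000000000 * (Fintype.card n : ℝ) * θ ≤ 1 := by rw [hθdef, hMr]; exact hθ
  have hθ1 : 1000000000000000000000 * θ ≤ 1 := by
    have : θ ≤ (Fintype.card n : ℝ) * θ := le_mul_of_one_le_left hθ0 hcard
    nlinarith
  -- §1 chart data
  have hθc : 1000000000000 * (Fintype.card n : ℝ) * (((2 : ℝ) ^ (k + 1)) ^ 2 * η) ≤ 1 := by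
    rw [← hMr, ← hθdef]
    have : 0 ≤ (Fintype.card n : ℝ) * θ := by positivity
    nlinarith
  obtain ⟨g, hgU, hpin, herr, hgeq, hτcc⟩ := exists_pair_chart_data hU' hUs hU'P hUsP hη hS' hSs htop hθc
  rw [← hMr] at herr hτcc
  -- §2 profiles and parity blocks
  obtain ⟨φ, hφ01, hφcore, hφsupp, hφlip, hφcov⟩ := exists_coreProfile_sharp (d := 4) hM1
  have hZ : ∀ c : Fin 4 → Fin 2, ∃ Z : Site 4 → Site 4,
      (∀ x, ∃ w : Site 4, Z x = (fun i => ((c i : ℕ) : ℤ)) + (2 : ℤ) • w) ∧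
      (∀ x i, |x i - (M : ℤ) * Z x i| ≤ (M : ℤ)) ∧
      (∀ (x ζ w : Site 4), ζ = (fun i => ((c i : ℕ) : ℤ)) + (2 : ℤ) • w →
        (∀ i, -(M : ℤ) ≤ x i - (M : ℤ) * ζ i ∧ x i - (M : ℤ) * ζ i < (M : ℤ)) → Z x = ζ) ∧
      (∀ (x : Site 4) (i : Fin 4), Z (x + ((2 * N * M : ℕ) : ℤ) • e i) = Z x + ((2 * N : ℕ) : ℤ) • e i) := by
    intro c
    obtain ⟨Z, h1, h2, h3, h4⟩ := exists_parityBlock_sharp (d := 4) hM1 (fun i => ((c i : ℕ) : ℤ))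
    exact ⟨Z, h1, h2, h3, fun x i => h4 x i N⟩
  -- §3 the gluing over the 16 parities
  set τcc : ℝ := 4358144 * θ with hτcc_def
  set ηch : ℝ := 262144 * (M : ℝ) * η with hηch_def
  have hηch0 : 0 ≤ ηch := by positivity
  set T : ℝ := (4 ^ (2 ^ 4) - 1) / 3 * τcc with hT
  have hTle : T ≤ 10000000000000000 * θ := by
    rw [hT, hτcc_def]; norm_num; nlinarith
  have hT0 : 0 ≤ T := by rw [hT]; positivity
  have hsmall : (4 ^ (2 ^ 4) - 1) / 3 * τcc ≤ 1 / 4 := by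
    show T ≤ 1 / 4
    nlinarith
  obtain ⟨u₀, hu₀U, hu₀pin, hu₀per, hu₀site, hu₀bond⟩ :=
    colour_glue (d := 4) hUs hU' hM2 hgU hpin hηch0 herr hgeq (by positivity : (0 : ℝ) ≤ τcc) hτcc hsmall hφ01 hφcore hφsupp hφlip hφcov hZ
  -- §4 the four halvings
  set E : ℝ := (6 ^ (2 ^ 4) - 1) / 5 * (7 * ηch + 16 * ((4 ^ (2 ^ 4) - 1) / 3 * τcc) / (M : ℝ)) with hE
  have hE0 : 0 ≤ E := by rw [hE]; positivity
  have h5832 : 5832 * T ≤ 1 := by nlinarith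
  obtain ⟨u, huU, hupin, -, huhalf, -, hubond⟩ :=
    symmetrise_all hU' hUs hM1 hN hU'P hUsP hgeq hT0 hE0 h5832 hu₀U hu₀pin hu₀per hu₀site hu₀bond 4 le_rfl
  -- §5 the final constant: `13⁴·(E + 64T/M) ≤ 10³⁴·Mη`
  have hMη : θ / (M : ℝ) = (M : ℝ) * η := by rw [hθdef]; field_simp
  have hEle : E ≤ 100000000000000000000000000000 * ((M : ℝ) * η) := by
    have h616 : ((6 : ℝ) ^ (2 ^ 4) - 1) / 5 ≤ 600000000000 := by norm_num
    have hin : 7 * ηch + 16 * ((4 ^ (2 ^ 4) - 1) / 3 * τcc) / (M : ℝ) ≤ 160000002000000000 * ((M : ℝ) * η) := by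
      have h1 : 16 * ((4 ^ (2 ^ 4) - 1) / 3 * τcc) / (M : ℝ) ≤ 160000000000000000 * ((M : ℝ) * η) := by
        rw [← hT, ← hMη]
        have := div_le_div_of_nonneg_right (mul_le_mul_of_nonneg_left hTle (by norm_num : (0 : ℝ) ≤ 16)) hM0.le
        calc 16 * T / (M : ℝ) ≤ 16 * (10000000000000000 * θ) / (M : ℝ) := this
          _ = 160000000000000000 * (θ / (M : ℝ)) := by ring
      have h2 : 7 * ηch ≤ 2000000 * ((M : ℝ) * η) := by rw [hηch_def]; nlinarith [mul_pos hM0 hη]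
      linarith
    have hin0 : 0 ≤ 7 * ηch + 16 * ((4 ^ (2 ^ 4) - 1) / 3 * τcc) / (M : ℝ) := by positivity
    calc E = ((6 : ℝ) ^ (2 ^ 4) - 1) / 5 * (7 * ηch + 16 * ((4 ^ (2 ^ 4) - 1) / 3 * τcc) / (M : ℝ)) := hE
      _ ≤ 600000000000 * (160000002000000000 * ((M : ℝ) * η)) := mul_le_mul h616 hin hin0 (by norm_num)
      _ ≤ _ := by nlinarith [mul_pos hM0 hη]
  have hfinal : (13 : ℝ) ^ 4 * (E + 16 * (4 : ℕ) * T / (M : ℝ)) ≤ 10000000000000000000000000000000000 * (2 : ℝ) ^ (k + 1) * η := by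
    rw [← hMr]
    have h1 : 16 * ((4 : ℕ) : ℝ) * T / (M : ℝ) ≤ 640000000000000000 * ((M : ℝ) * η) := by
      rw [← hMη]
      have := div_le_div_of_nonneg_right (mul_le_mul_of_nonneg_left hTle (by norm_num : (0 : ℝ) ≤ 64)) hM0.le
      calc 16 * ((4 : ℕ) : ℝ) * T / (M : ℝ) = 64 * T / (M : ℝ) := by push_cast; ring
        _ ≤ 64 * (10000000000000000 * θ) / (M : ℝ) := this
        _ = 640000000000000000 * (θ / (M : ℝ)) := by ring
    have h13 : (13 : ℝ) ^ 4 = 28561 := by norm_num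
    rw [h13]
    nlinarith [mul_pos hM0 hη]
  refine ⟨u, huU, fun x j => huhalf x j j.isLt, hupin, fun x μ => (hubond x μ).trans ?_⟩
  exact hfinal

end

end Summit.QuantumFields.BalabanUV.T4Continuum.NE7PairResidualSupRep
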